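import Summits.QuantumFields.YangMills.Theorems.UnitScaleTiltProp7TiledCubeMemberH7H8In
import HarnessLib

/-!
# Route `UnitScaleTilt`, crux K1 «MinimiserStabilityRegPr» (stmt-QuantumFields-19200) — route-R E′ (A′), LANE II «DIVERGENCE RECOVERY AT CURVED `W`» (★★OWNER RULING №23),
# (B7) [I-5]∕[I-9] (a′) FILE 6a — **`h7 ⊕ h8` AT THE MEMBER, PEELED FORM: STAGE A** (★p1 g19 NAMER WORD №16, 2026-08-29 12:46Z, adopting w1-19200 g16's (P2) «PEEL, DON'T
# RE-ANCHOR»): the rows of ⧗p717841 `h7h8_member_in` with every `Ω`-sum — the box mass on the left, the coarse `Ū`-difference sum `Gc`, the px5 conversion costs —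
# taken over an INNER CONCENTRIC TILED BOX `Ω_f = box z R_in` (`R_in + p·ℓ = R_f`, blocks `lo′ + [0, m′]³`, record `p = 4`, `lo′ = lo + 4`, `m′ = m − 8`), while
# the anchor (0) `Σ_{box z R_f} Ad(u w)φ_Z(w) = 0`, the chart-function row `hφZ`, the plaquette hypothesis `hP` and the inside chart energy `Gφ_in` stay on the FULL
# chart box `box z R_f` EXACTLY as ⧗`patch_alpha_member` exports them ((0), (S1b), (P-box), (h1)) — nothing new is asked of (B8).  The mean of `Ad(u)φ_Z` over
# `Ω_f` no longer vanishes; it is paid by ✓px4 `Prop7LatticeTiledCube.norm_sum_axial_sq_le_of_normalised (t := p·ℓ)` from (0) on the full box, giving ONE extra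
# displayed term `8·(#(box∖Ω_f)∕#Ω_f)·[(4dt∕(2R_f+1) + 32dt(2R_f+1)(2dR_fα)²)·‖φ‖² + 8t(2R_f+1)·η²·Gφ_in]` (K-uniform: `#(box∖Ω_f)∕#Ω_f = O(R₀⁻¹)`, `t∕(2R_f+1) = O(R₀⁻¹)`,
# `t(2R_f+1)η² = O(R₀)·(ηℓ)² = O(R₀)`).  WHY PEEL: w1 g16's witness (bus 12:35:39Z) — h9 is FALSE for `Gc` over ALL coarse bonds of the chart box (the bottom∕top
# block layers' read sets leave the local-equation region); on the peeled bonds (both endpoints in `Ω_f`) ✓p715415 `coarseGrad_rows_on_inner` applies with w1's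
# box-plateau cutoff `χ`.

Cell `ym3-torus` ∕ width seat `ym3-torus-px9` (gen 8, «width 9»).  THEOREMS ONLY (0 `def`, 0 `sorry`); `--supports stmt-QuantumFields-19200 --as helper`, count-neutral.
YM₃ on T³ is a ladder rung (R3), not d = 4, not the Clay problem; nothing here claims (B7), (REC), `hN06`, E′, EX or the gap.

WHAT IS PROVED (ns `…Theorems.Prop7TiledCubeMemberH7H8PeeledA`): `knit_arith_peeled` (pure arithmetic) · ★★ `knitA_peeled` (stage A on the inner box, mean kept and paid
by (0)) · `peeled_tiled` (the inner box's two tiling equations from the outer ones).  Stage B (`h7h8_core_peeled`, ★★★ `h7h8_member_peeled`) is FILE 6b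
`…TiledCubeMemberH7H8Peeled`.
HONEST SCOPE.  Bookkeeping over landed rows ((B9d), px4 §6, px5 [I-5-conv], FILES 1–5); nothing of (B7)∕(REC)∕`hN06`∕the crux is asserted; rung R3, not Clay; YM gap NOT proved.

References: T. Bałaban, CMP 98 (1985) 17–51 [Balaban1985Averaging] ((20) p.21, pp.24–25: blockwise Poincaré with the mean term); T. Bałaban, CMP 99 (1985) 389–434
[Balaban1985BackgroundPropagators] ((3.19) p.393, (3.100) p.413: localisation with collars); T. Bałaban, CMP 99 (1985) 75–102 [Balaban1985RegularSpaces] ((1.3) p.77).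
-/

set_option autoImplicit false

open scoped BigOperators Matrix.Norms.L2Operator

namespace Summit.QuantumFields.YangMills.Theorems.Prop7TiledCubeMemberH7H8PeeledA

open Literature.MathematicalPhysics.QuantumFieldTheory.Balaban1983to89
open Literature.MathematicalPhysics.QuantumFieldTheory.Balaban1983to89.T3ContinuumYM3Torus
open Literature.MathematicalPhysics.QuantumFieldTheory.Balaban1983to89.T3PrintedRegularMinimiser (RegPr)
open Literature.MathematicalPhysics.QuantumFieldTheory.Balaban1983to89.B4Eq19LatticeOperators (Zd box unitVec mem_box box_mono)
open Literature.MathematicalPhysics.QuantumLattice (blockMap blockBase blockSites)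
open B10Eq27TorusAxialLog (transl pull pull_apply holT unitsField toUField)
open B7Prop1Explicit (axialFn U1 e)
open B7Prop2Explicit (C0 c2')
open B7Eq78Linearization (conjR QprimeIter zdBlocking)
open B8Eq119TwistedAxial (bgT)
open B9B8AveragingKernelZd (blockIter)
open T4TermwiseTorus (tlift)
open T3SectALandauChart (eta eta_pos bgUnits)
open B11Eq103H1Complex (SiteL2K BondL2K)
open Summit.QuantumFields.YangMills.Theorems.Prop7SectET3Transport (periodsT3)
open Summit.QuantumFields.YangMills.Theorems.Prop7SectET3HilbertLetters (W₂ toL2 toL2S DL2)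
open Summit.QuantumFields.YangMills.Theorems.Prop7SPrint (basePt)
open Summit.QuantumFields.YangMills.Theorems.Prop7QprimeCombL2 (QprimeCombL2)
open Summit.QuantumFields.YangMills.Theorems.Prop7LatticeTiledCube (sum_tiled_sq_le_plaq norm_sum_axial_sq_le_of_normalised card_tiled)
open Summit.QuantumFields.YangMills.Theorems.Prop7TiledCubeMemberRows (chart_mass_le eta_sq_sum_opNorm_sq_le_norm_sq)
open Summit.QuantumFields.YangMills.Theorems.Prop7CombVsAxialMeansMember (sum_sq_grad_conv_of_regPr)
open Summit.QuantumFields.YangMills.Theorems.Prop7TiledCubeMemberKnit (blockIter_eq_blk tiled_eq_box_of succ_le_sitesPerDir_of knitB_arith weight_eq)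
open Summit.QuantumFields.YangMills.Theorems.Prop7TiledCubeMemberH7H8 (sum_normSq_axialDiff_eq sum_C_src_le sum_C_tgt_le sum_C_normSq_combDiff_eq)

variable (F : T3Family) (n K : ℕ) (c₀ : ℝ) [Fact (0 < c₀)]

/-! ## §0 Arithmetic of the peeled stage A -/

omit [Fact (0 < c₀)] in
/-- Pure arithmetic of the peeled knit: (B9d)'s right side on the inner box in member currency, the mean term paid through `NS ≤ Lay·(a₁·SB + a₂·COVB)`
(px4's row) with `Bk·ℓd = #Ω`. [folklore] -/
theorem knit_arith_peeled {c₀ η ℓr cc COV S DIFF d β ℓd cm Nr G Φ LHS Bk MEAN NS Ωc Lay a₁ a₂ SB COVB : ℝ}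
    (hc : 0 ≤ c₀) (hCOV0 : 0 ≤ COV) (hS0 : 0 ≤ S) (hd : 0 ≤ d) (hN : Nr = 2)
    (hA : LHS ≤ 2 * (c₀ * η ^ 2) * S)
    (h9 : S ≤ 2 * (Nr * cc * (2 * COV + 8 * d * β ^ 2 * S)) + 2 * ℓd * (2 * (Nr * cm * DIFF) + 2 * Bk * MEAN))
    (hB : c₀ * COV ≤ G) (hC : c₀ * η ^ 2 * S ≤ Φ)
    (hcc1 : cc * η ^ 2 ≤ 1 / 2) (hcc2 : cc ≤ ℓr ^ 2 / 2)
    (hMEAN : MEAN ≤ Ωc⁻¹ ^ 2 * NS) (hNS : NS ≤ Lay * (a₁ * SB + a₂ * COVB))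
    (hCB : c₀ * η ^ 2 * SB ≤ Φ) (hBB : c₀ * COVB ≤ G)
    (hΩ : Bk * ℓd = Ωc) (hΩc : 0 < Ωc) (hLay : 0 ≤ Lay) (ha₁ : 0 ≤ a₁) (ha₂ : 0 ≤ a₂) :
    LHS ≤ 8 * G
      + (32 * ℓr ^ 2 * β ^ 2 * d * Φ + 8 * (Lay * Ωc⁻¹) * (a₁ * Φ + a₂ * (η ^ 2 * G)))
      + 2 * (c₀ * η ^ 2) * (2 * ℓd * (2 * (2 * cm * DIFF))) := by
  subst hN
  have hη2 : 0 ≤ η ^ 2 := sq_nonneg η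
  have p1 : cc * η ^ 2 * (c₀ * COV) ≤ 1 / 2 * G :=
    mul_le_mul hcc1 hB (mul_nonneg hc hCOV0) (by norm_num)
  have p2 : cc * (c₀ * η ^ 2 * S) ≤ ℓr ^ 2 / 2 * Φ :=
    mul_le_mul hcc2 hC (by positivity) (by positivity)
  have p3 : 2 * (c₀ * η ^ 2) * S
      ≤ 2 * (c₀ * η ^ 2) * (2 * (2 * cc * (2 * COV + 8 * d * β ^ 2 * S)) + 2 * ℓd * (2 * (2 * cm * DIFF) + 2 * Bk * MEAN)) :=
    mul_le_mul_of_nonneg_left h9 (by positivity)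
  have p4 : d * β ^ 2 * (cc * (c₀ * η ^ 2 * S)) ≤ d * β ^ 2 * (ℓr ^ 2 / 2 * Φ) :=
    mul_le_mul_of_nonneg_left p2 (by positivity)
  -- the mean piece: `2c₀η²·2ℓd·2Bk·MEAN = 8·c₀η²·(Bk·ℓd)·MEAN ≤ 8·c₀η²·Ωc·Ωc⁻²·NS = 8·Ωc⁻¹·(c₀η²·NS)`
  have q1 : Bk * ℓd * MEAN ≤ Ωc * (Ωc⁻¹ ^ 2 * NS) := by
    rw [hΩ]; exact mul_le_mul_of_nonneg_left hMEAN hΩc.le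
  have q1' : Ωc * (Ωc⁻¹ ^ 2 * NS) = Ωc⁻¹ * NS := by
    field_simp
  have q2 : c₀ * η ^ 2 * NS ≤ Lay * (a₁ * Φ + a₂ * (η ^ 2 * G)) := by
    have h1 : c₀ * η ^ 2 * NS ≤ c₀ * η ^ 2 * (Lay * (a₁ * SB + a₂ * COVB)) := mul_le_mul_of_nonneg_left hNS (by positivity)
    have e1 : c₀ * η ^ 2 * (Lay * (a₁ * SB + a₂ * COVB)) = Lay * (a₁ * (c₀ * η ^ 2 * SB) + a₂ * (η ^ 2 * (c₀ * COVB))) := by ring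
    have h2 : a₁ * (c₀ * η ^ 2 * SB) ≤ a₁ * Φ := mul_le_mul_of_nonneg_left hCB ha₁
    have h3 : a₂ * (η ^ 2 * (c₀ * COVB)) ≤ a₂ * (η ^ 2 * G) := mul_le_mul_of_nonneg_left (mul_le_mul_of_nonneg_left hBB hη2) ha₂
    have h4 : Lay * (a₁ * (c₀ * η ^ 2 * SB) + a₂ * (η ^ 2 * (c₀ * COVB))) ≤ Lay * (a₁ * Φ + a₂ * (η ^ 2 * G)) :=
      mul_le_mul_of_nonneg_left (add_le_add h2 h3) hLay
    linarith
  have q3 : 2 * (c₀ * η ^ 2) * (2 * ℓd * (2 * Bk * MEAN)) ≤ 8 * (Lay * Ωc⁻¹) * (a₁ * Φ + a₂ * (η ^ 2 * G)) := by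
    have e1 : 2 * (c₀ * η ^ 2) * (2 * ℓd * (2 * Bk * MEAN)) = 8 * (c₀ * η ^ 2) * (Bk * ℓd * MEAN) := by ring
    rw [e1]
    have h1 : 8 * (c₀ * η ^ 2) * (Bk * ℓd * MEAN) ≤ 8 * (c₀ * η ^ 2) * (Ωc⁻¹ * NS) := by
      rw [← q1']; exact mul_le_mul_of_nonneg_left q1 (by positivity)
    have e2 : 8 * (c₀ * η ^ 2) * (Ωc⁻¹ * NS) = 8 * Ωc⁻¹ * (c₀ * η ^ 2 * NS) := by ring
    have h2 : 8 * Ωc⁻¹ * (c₀ * η ^ 2 * NS) ≤ 8 * Ωc⁻¹ * (Lay * (a₁ * Φ + a₂ * (η ^ 2 * G))) :=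
      mul_le_mul_of_nonneg_left q2 (by positivity)
    have e3 : 8 * Ωc⁻¹ * (Lay * (a₁ * Φ + a₂ * (η ^ 2 * G))) = 8 * (Lay * Ωc⁻¹) * (a₁ * Φ + a₂ * (η ^ 2 * G)) := by ring
    linarith
  have e : 2 * (c₀ * η ^ 2) * (2 * (2 * cc * (2 * COV + 8 * d * β ^ 2 * S)) + 2 * ℓd * (2 * (2 * cm * DIFF) + 2 * Bk * MEAN))
      = 16 * (cc * η ^ 2 * (c₀ * COV)) + 64 * (d * β ^ 2 * (cc * (c₀ * η ^ 2 * S)))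
        + 2 * (c₀ * η ^ 2) * (2 * ℓd * (2 * (2 * cm * DIFF))) + 2 * (c₀ * η ^ 2) * (2 * ℓd * (2 * Bk * MEAN)) := by ring
  have e' : 32 * ℓr ^ 2 * β ^ 2 * d * Φ = 64 * (d * β ^ 2 * (ℓr ^ 2 / 2 * Φ)) := by ring
  linarith [p1, p3, p4, e, e', q3]

/-! ## §1 Stage A on the inner box, the mean paid by (0) on the full box -/

/-- ★★ **STAGE A, PEELED** — for any chart centre `c`, the FULL chart box `box z R_f` (`2R_f + 1 ≤ N₀`, `0 ≤ R_f`) carrying the pull-back `V` of `W` with `PlaqSmall V (z−R_f) (z+R_f) α`,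
the chart function `φ_Z` of the member field `φ` (row `hφZ` on the full box) and the anchor (0) `h0` on the FULL box, and an INNER CONCENTRIC TILED BOX `box z R_in` (`R_in + t = R_f`,
`t : ℕ`) that is exactly the tiled cube of the blocks `b ∈ lo′ + [0, m′]^d` (`hbox`):
`c₀Σ_{w ∈ box z R_in}hs(φ♭(c + w)) ≤ 8·Gφ_in(box z R_f) + 32ℓ²(2dR_fα)²d‖φ‖² + 8·(#(box z R_f ∖ box z R_in)∕#(box z R_in))·[(4dt∕(2R_f+1) + 32dt(2R_f+1)(2dR_fα)²)·‖φ‖² + 8t(2R_f+1)·η²·Gφ_in(box z R_f)]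
 + 2c₀η²·(2ℓ^d·(2·(2·(m′(m′+1)∕2)·DIFF)))`, `DIFF` = (B9d)'s coarse double sum over the axial (base `z − R_f`) block means of `φ_Z` on the inner cube.
[cite: Balaban1985Averaging, pp.24-25; Balaban1985BackgroundPropagators, (3.100) p.413] -/
theorem knitA_peeled (W : GaugeField (F.P K) 0 (Matrix.specialUnitaryGroup (Fin 2) ℂ))
    (c : Site (F.P K) 0) {z : Zd (F.P K).d} {Rf Rin : ℤ} (hRf0 : 0 ≤ Rf) (hRN : 2 * Rf + 1 ≤ ((F.P K).sitesPerDir 0 : ℤ))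
    (t : ℕ) (hRin : Rin + (t : ℤ) = Rf)
    (lo' : Zd (F.P K).d) (m' : ℕ)
    (hbox : Fintype.piFinset (fun i => Finset.Icc (((F.L ^ (K - n) : ℕ) : ℤ) * lo' i) (((F.L ^ (K - n) : ℕ) : ℤ) * lo' i + (((m' + 1) * F.L ^ (K - n) - 1 : ℕ) : ℤ)))
      = box z Rin)
    (V : Zd (F.P K).d → Fin (F.P K).d → (Matrix (Fin 2) (Fin 2) ℂ)ˣ) (hV : ∀ w μ, V w μ = unitsField (toUField W) ⟨transl c w, μ⟩)
    {α : ℝ} (hα : 0 ≤ α) (hP : B8Lemma1NonAbelian.PlaqSmall V (fun i => z i - Rf) (fun i => z i + Rf) α)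
    (φ : SiteL2K ℂ 3 (periodsT3 F K) c₀ W₂) (φZ : Zd (F.P K).d → Matrix (Fin 2) (Fin 2) ℂ)
    (hφZ : ∀ w ∈ box z Rf, (toL2S F K c₀).symm φ (transl c w) = (eta F n K) • φZ w)
    (h0 : ∑ w ∈ box z Rf, conjR (axialFn V (fun i => z i - Rf) w) (φZ w) = 0) :
    c₀ * ∑ w ∈ box z Rin, ∑ j : Fin 2, ∑ k : Fin 2, ‖((toL2S F K c₀).symm φ (transl c w)) j k‖ ^ 2
      ≤ 8 * (c₀ * ∑ w ∈ box z Rf, ∑ μ, (if w + unitVec μ ∈ box z Rf then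
            ∑ j : Fin 2, ∑ k : Fin 2, ‖(conjR (V w μ) (φZ (w + unitVec μ)) - φZ w) j k‖ ^ 2 else 0))
        + (32 * ((F.L : ℝ) ^ (K - n)) ^ 2 * (2 * ((F.P K).d : ℝ) * Rf * α) ^ 2 * ((F.P K).d : ℝ) * ‖φ‖ ^ 2
          + 8 * (((box z Rf \ box z Rin).card : ℝ) * ((box z Rin).card : ℝ)⁻¹) *
            ((4 * ((F.P K).d : ℝ) * t / (2 * (Rf : ℝ) + 1) + 32 * ((F.P K).d : ℝ) * t * (2 * (Rf : ℝ) + 1) * (2 * ((F.P K).d : ℝ) * Rf * α) ^ 2) * ‖φ‖ ^ 2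
              + 8 * t * (2 * (Rf : ℝ) + 1) * ((eta F n K) ^ 2 *
                (c₀ * ∑ w ∈ box z Rf, ∑ μ, (if w + unitVec μ ∈ box z Rf then
                  ∑ j : Fin 2, ∑ k : Fin 2, ‖(conjR (V w μ) (φZ (w + unitVec μ)) - φZ w) j k‖ ^ 2 else 0)))))
        + 2 * (c₀ * (eta F n K) ^ 2) * (2 * (((F.L ^ (K - n)) ^ (F.P K).d : ℕ) : ℝ) *
          (2 * (2 * ((m' : ℝ) * (m' + 1) / 2) *
              ∑ b ∈ Fintype.piFinset (fun i => Finset.Icc (lo' i) (lo' i + m')), ∑ μ,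
                (if b + unitVec μ ∈ Fintype.piFinset (fun i => Finset.Icc (lo' i) (lo' i + m')) then
                  ‖((((F.L ^ (K - n)) ^ (F.P K).d : ℕ) : ℝ) : ℂ)⁻¹ • ∑ x' ∈ Fintype.piFinset (fun i => Finset.Icc (((F.L ^ (K - n) : ℕ) : ℤ) * (b + unitVec μ) i) (((F.L ^ (K - n) : ℕ) : ℤ) * (b + unitVec μ) i + ((F.L ^ (K - n) - 1 : ℕ) : ℤ))),
                      conjR (axialFn V (fun i => z i - Rf) x') (φZ x')
                    - ((((F.L ^ (K - n)) ^ (F.P K).d : ℕ) : ℝ) : ℂ)⁻¹ • ∑ x' ∈ Fintype.piFinset (fun i => Finset.Icc (((F.L ^ (K - n) : ℕ) : ℤ) * b i) (((F.L ^ (K - n) : ℕ) : ℤ) * b i + ((F.L ^ (K - n) - 1 : ℕ) : ℤ))),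
                      conjR (axialFn V (fun i => z i - Rf) x') (φZ x')‖ ^ 2
                else 0)))) := by
  classical
  have hc : 0 < c₀ := Fact.out
  have hL : 0 < F.L := by have := F.hL.2; omega
  have hLR : (0 : ℝ) < F.L := by exact_mod_cast hL
  have hℓ : 1 ≤ F.L ^ (K - n) := Nat.one_le_pow _ _ hL
  have ht0 : (0 : ℤ) ≤ (t : ℤ) := Int.natCast_nonneg t
  have hRin_le : Rin ≤ Rf := by omega
  have hsubB : box z Rin ⊆ box z Rf := box_mono z hRin_le
  -- the pull-back connection is unitary
  have hVu : ∀ w μ, V w μ ∈ B7Prop2Explicit.unitaryUnits (Matrix (Fin 2) (Fin 2) ℂ) := fun w μ => by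
    rw [hV]; exact B10Eq27TorusAxialLog.unitsField_mem_unitaryUnits (toUField W) _
  have hsub : Fintype.piFinset (fun i => Finset.Icc (((F.L ^ (K - n) : ℕ) : ℤ) * lo' i)
      (((F.L ^ (K - n) : ℕ) : ℤ) * lo' i + (((m' + 1) * F.L ^ (K - n) - 1 : ℕ) : ℤ))) ⊆ box z Rf := hbox.le.trans hsubB
  -- (B9d) on the inner tiled cube = the inner box, the mean KEPT
  have h9 := sum_tiled_sq_le_plaq (N := 2) hℓ lo' m' hα V hVu hP hsub φZ
  -- the inner cube's cardinality: `#blocks · ℓ^d = #(box z R_in)`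
  have hcardN := card_tiled (d := (F.P K).d) hℓ lo' m'
  rw [hbox] at h9 hcardN
  -- the mean over the inner box is paid by (0) on the full box (px4 §6)
  have hinner : box z (Rf - t) ⊆ box z Rin := box_mono z (by omega)
  have hM := norm_sum_axial_sq_le_of_normalised (N := 2) hRf0 t hα V hVu hP φZ h0 hsubB hinner
  -- the member rows (FILE 1), on the inner box and on the full box
  have hA := chart_mass_le F n K c₀ c φ φZ hφZ (box z Rin) hsubB
  have hB : c₀ * ∑ x ∈ box z Rin, ∑ μ, (if x + unitVec μ ∈ box z Rin then ‖conjR (V x μ) (φZ (x + unitVec μ)) - φZ x‖ ^ 2 else 0)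
      ≤ (c₀ * ∑ w ∈ box z Rf, ∑ μ, (if w + unitVec μ ∈ box z Rf then
            ∑ j : Fin 2, ∑ k : Fin 2, ‖(conjR (V w μ) (φZ (w + unitVec μ)) - φZ w) j k‖ ^ 2 else 0)) := by
    refine mul_le_mul_of_nonneg_left ?_ hc.le
    calc ∑ x ∈ box z Rin, ∑ μ, (if x + unitVec μ ∈ box z Rin then ‖conjR (V x μ) (φZ (x + unitVec μ)) - φZ x‖ ^ 2 else 0)
        ≤ ∑ x ∈ box z Rin, ∑ μ, (if x + unitVec μ ∈ box z Rf then
            ∑ j : Fin 2, ∑ k : Fin 2, ‖(conjR (V x μ) (φZ (x + unitVec μ)) - φZ x) j k‖ ^ 2 else 0) :=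
          Finset.sum_le_sum fun x _ => Finset.sum_le_sum fun μ _ => by
            by_cases h : x + unitVec μ ∈ box z Rin
            · rw [if_pos h, if_pos (hsubB h)]; exact MatrixNorms.opNorm_sq_le_sum_norm_sq _
            · rw [if_neg h]; split_ifs <;> positivity
      _ ≤ _ := Finset.sum_le_sum_of_subset_of_nonneg hsubB fun x _ _ =>
          Finset.sum_nonneg fun μ _ => by split_ifs <;> positivity
  have hBB : c₀ * ∑ x ∈ box z Rf, ∑ μ, (if x + unitVec μ ∈ box z Rf then ‖conjR (V x μ) (φZ (x + unitVec μ)) - φZ x‖ ^ 2 else 0)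
      ≤ (c₀ * ∑ w ∈ box z Rf, ∑ μ, (if w + unitVec μ ∈ box z Rf then
            ∑ j : Fin 2, ∑ k : Fin 2, ‖(conjR (V w μ) (φZ (w + unitVec μ)) - φZ w) j k‖ ^ 2 else 0)) :=
    mul_le_mul_of_nonneg_left (Finset.sum_le_sum fun w _ => Finset.sum_le_sum fun μ _ => by
      split_ifs
      · exact MatrixNorms.opNorm_sq_le_sum_norm_sq _
      · exact le_rfl) hc.le
  have hC := eta_sq_sum_opNorm_sq_le_norm_sq F n K c₀ c hRN φ φZ hφZ (box z Rin) hsubB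
  have hCB := eta_sq_sum_opNorm_sq_le_norm_sq F n K c₀ c hRN φ φZ hφZ (box z Rf) (Finset.Subset.refl _)
  -- scale facts: `η ℓ = 1`, `c = ℓ(ℓ−1)/2 ≤ ℓ²/2`
  have hηℓ : eta F n K * (F.L : ℝ) ^ (K - n) = 1 := by
    show ((F.L : ℝ)⁻¹) ^ (K - n) * (F.L : ℝ) ^ (K - n) = 1
    rw [← mul_pow, inv_mul_cancel₀ hLR.ne', one_pow]
  have hsq : ((F.L : ℝ) ^ (K - n)) ^ 2 * (eta F n K) ^ 2 = 1 := by rw [← mul_pow, mul_comm, hηℓ, one_pow]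
  have e1 : (((F.L ^ (K - n) - 1 : ℕ) : ℝ) + 1) = (F.L : ℝ) ^ (K - n) := by
    rw [Nat.cast_sub hℓ]; push_cast; ring
  have hcc2 : ((F.L ^ (K - n) - 1 : ℕ) : ℝ) * (((F.L ^ (K - n) - 1 : ℕ) : ℝ) + 1) / 2 ≤ ((F.L : ℝ) ^ (K - n)) ^ 2 / 2 := by
    rw [e1]
    have e2 : ((F.L ^ (K - n) - 1 : ℕ) : ℝ) ≤ (F.L : ℝ) ^ (K - n) := by linarith [e1]
    have h0' : (0 : ℝ) ≤ (F.L : ℝ) ^ (K - n) := by positivity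
    nlinarith [e2, h0']
  have hcc1 : ((F.L ^ (K - n) - 1 : ℕ) : ℝ) * (((F.L ^ (K - n) - 1 : ℕ) : ℝ) + 1) / 2 * (eta F n K) ^ 2 ≤ 1 / 2 := by
    have := mul_le_mul_of_nonneg_right hcc2 (sq_nonneg (eta F n K))
    have e3 : ((F.L : ℝ) ^ (K - n)) ^ 2 / 2 * (eta F n K) ^ 2 = 1 / 2 := by
      rw [div_mul_eq_mul_div, hsq]
    linarith [e3]
  have hCOV0 : 0 ≤ ∑ x ∈ box z Rin, ∑ μ, (if x + unitVec μ ∈ box z Rin then ‖conjR (V x μ) (φZ (x + unitVec μ)) - φZ x‖ ^ 2 else 0) :=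
    Finset.sum_nonneg fun x _ => Finset.sum_nonneg fun μ _ => by split_ifs <;> positivity
  have hS0 : 0 ≤ ∑ x ∈ box z Rin, ‖φZ x‖ ^ 2 := Finset.sum_nonneg fun x _ => by positivity
  have hd0 : (0 : ℝ) ≤ ((F.P K).d : ℝ) := Nat.cast_nonneg _
  have hN : ((2 : ℕ) : ℝ) = 2 := by norm_num
  -- the cardinality bookkeeping of the mean term
  have hΩ : ((Fintype.piFinset (fun i => Finset.Icc (lo' i) (lo' i + m'))).card : ℝ) * ((((F.L ^ (K - n)) ^ (F.P K).d : ℕ) : ℝ))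
      = ((box z Rin).card : ℝ) := by
    rw [hcardN]; push_cast; ring
  have hΩc : (0 : ℝ) < ((box z Rin).card : ℝ) := by
    rw [hcardN]
    have h1 : 0 < (Fintype.piFinset (fun i => Finset.Icc (lo' i) (lo' i + m'))).card :=
      Finset.card_pos.mpr ⟨lo', Fintype.mem_piFinset.mpr fun i => Finset.mem_Icc.mpr ⟨le_rfl, by omega⟩⟩
    have h2 : 0 < (F.L ^ (K - n)) ^ (F.P K).d := pow_pos (pow_pos hL _) _
    exact_mod_cast Nat.mul_pos h1 h2
  have hMEAN : ‖((((box z Rin).card : ℝ)) : ℂ)⁻¹ • ∑ x ∈ box z Rin, conjR (axialFn V (fun i => z i - Rf) x) (φZ x)‖ ^ 2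
      ≤ ((box z Rin).card : ℝ)⁻¹ ^ 2 * ‖∑ x ∈ box z Rin, conjR (axialFn V (fun i => z i - Rf) x) (φZ x)‖ ^ 2 := by
    rw [norm_smul, norm_inv, Complex.norm_real, Real.norm_of_nonneg hΩc.le, mul_pow]
  have hLay : (0 : ℝ) ≤ ((box z Rf \ box z Rin).card : ℝ) := Nat.cast_nonneg _
  have hRf0' : (0 : ℝ) ≤ (Rf : ℝ) := by exact_mod_cast hRf0
  have h2R : (0 : ℝ) ≤ 2 * (Rf : ℝ) + 1 := by positivity
  have ht' : (0 : ℝ) ≤ (t : ℝ) := Nat.cast_nonneg t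
  have ha₁ : (0 : ℝ) ≤ 4 * ((F.P K).d : ℝ) * t / (2 * (Rf : ℝ) + 1) + 32 * ((F.P K).d : ℝ) * t * (2 * (Rf : ℝ) + 1) * (2 * ((F.P K).d : ℝ) * Rf * α) ^ 2 :=
    add_nonneg (div_nonneg (mul_nonneg (mul_nonneg (by norm_num) hd0) ht') h2R)
      (mul_nonneg (mul_nonneg (mul_nonneg (mul_nonneg (by norm_num) hd0) ht') h2R) (sq_nonneg _))
  have ha₂ : (0 : ℝ) ≤ 8 * (t : ℝ) * (2 * (Rf : ℝ) + 1) := mul_nonneg (mul_nonneg (by norm_num) ht') h2R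
  exact knit_arith_peeled hc.le hCOV0 hS0 hd0 hN hA h9 hB hC hcc1 hcc2 hMEAN hM hCB hBB hΩ hΩc hLay ha₁ ha₂

/-! ## §2 The inner box's tiling from the outer one -/

omit [Fact (0 < c₀)] in
/-- **THE PEELED BOX IS TILED**: if `box z R_f` is the tiled cube of the blocks `lo + [0, m]^d` (`hzlo`, `hzhi`) and `2p ≤ m`, then `box z (R_f − p·ℓ)` is the tiled cube of
`(lo + p) + [0, m − 2p]^d`: the two defining equations of ⧗`h7h8_member_in`∕`h7h8_member_peeled` for the inner data. [cite: Balaban1985Averaging, pp.24-25] -/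
theorem peeled_tiled {z : Zd (F.P K).d} {Rf : ℤ} (lo : Zd (F.P K).d) (m p : ℕ) (hp : 2 * p ≤ m)
    (hzlo : ∀ i, z i - Rf = ((F.L ^ (K - n) : ℕ) : ℤ) * lo i)
    (hzhi : ∀ i, z i + Rf = ((F.L ^ (K - n) : ℕ) : ℤ) * lo i + (((m + 1) * F.L ^ (K - n) - 1 : ℕ) : ℤ)) :
    (∀ i, z i - (Rf - (p : ℤ) * ((F.L ^ (K - n) : ℕ) : ℤ)) = ((F.L ^ (K - n) : ℕ) : ℤ) * (lo i + p)) ∧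
    (∀ i, z i + (Rf - (p : ℤ) * ((F.L ^ (K - n) : ℕ) : ℤ))
        = ((F.L ^ (K - n) : ℕ) : ℤ) * (lo i + p) + (((m - 2 * p + 1) * F.L ^ (K - n) - 1 : ℕ) : ℤ)) ∧
    (Rf - (p : ℤ) * ((F.L ^ (K - n) : ℕ) : ℤ)) + ((p * F.L ^ (K - n) : ℕ) : ℤ) = Rf := by
  have hL : 0 < F.L := by have := F.hL.2; omega
  have hℓ : 1 ≤ F.L ^ (K - n) := Nat.one_le_pow _ _ hL
  have h1 : 1 ≤ (m + 1) * F.L ^ (K - n) := Nat.one_le_iff_ne_zero.mpr (by positivity)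
  have h2 : 1 ≤ (m - 2 * p + 1) * F.L ^ (K - n) := Nat.one_le_iff_ne_zero.mpr (by positivity)
  have e1 : (((m + 1) * F.L ^ (K - n) - 1 : ℕ) : ℤ) = ((m : ℤ) + 1) * ((F.L ^ (K - n) : ℕ) : ℤ) - 1 := by
    rw [Nat.cast_sub h1]; push_cast; ring
  have e2 : (((m - 2 * p + 1) * F.L ^ (K - n) - 1 : ℕ) : ℤ) = ((m : ℤ) - 2 * p + 1) * ((F.L ^ (K - n) : ℕ) : ℤ) - 1 := by
    rw [Nat.cast_sub h2]; push_cast [Nat.cast_sub hp]; ring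
  have e3 : ((p * F.L ^ (K - n) : ℕ) : ℤ) = (p : ℤ) * ((F.L ^ (K - n) : ℕ) : ℤ) := by push_cast; ring
  refine ⟨fun i => ?_, fun i => ?_, by rw [e3]; ring⟩
  · have h := hzlo i
    linear_combination h
  · have h := hzhi i
    rw [e1] at h
    rw [e2]
    linear_combination h

end Summit.QuantumFields.YangMills.Theorems.Prop7TiledCubeMemberH7H8PeeledA
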